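import Summits.HodgeConjecture.CorCM.IrreducibleOddWeightsCanonicalPivot
import Summits.HodgeConjecture.CorCM.IrreducibleOddWeightsRightIdealsPivotFamilies
import HarnessLib

/-!
# Canonical pivot, IV: FAMILIES — the exact defect `Σ_i dim Hg(A_i) − dim Hg(∏_i A_i)` with NO hypothesis, from the
# matrix coefficients of each slot summed over the orbits of the pointwise stabiliser of ALL OTHER slots

COR-CM (cell `pub-hodgecm2`, binder seat `b16` gen 65, count-neutral claim CANONICAL PIVOT, file C4 — abstract `G`-set
level; theorems only, no definition, no named fact, no `sorry`).  NEW as stated, hence under `Summits/`.  HONEST FRAMING: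
finite-dimensional linear algebra about the Kubota–Dodson rank of a family of CM types (`dim Hg(∏_i A_i)` versus
`Σ_i dim Hg(A_i)`); `HC_CM` is neither used nor asserted.

SETTING (gen 64 R1/R5 `IrreducibleOddWeightsRightIdeals{,PivotFamilies}`, C1 `IrreducibleOddWeightsCanonicalPivot`).
Slots `E_i` (`i ∈ I`), types `Φ_i`, matrix-coefficient spaces `MC_i ≤ ℚ^G`.  R1: `Σ_i dim Hg(A_i) − dim Hg(∏_i A_i) =
Σ_i dim MC_i − dim Σ_i MC_i` (the dimension of the space of RELATIONS `Σ_i c_i = 0`, `c_i ∈ MC_i`).  R5: in a relation,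
the component `c_j` is right-invariant under the pointwise stabiliser `PW_j` of its own slot and under `⋂_{i≠j} PW_i`;
R5 then assumed ONE subgroup `N ≤ ⟨PW_j ∪ ⋂_{i≠j} PW_i⟩` transitive on the fibres of a pivot in every slot (for `Aut(ℂ)`:
(GL) «each Galois closure meets the compositum of the others inside the pivot field»).  Here the subgroups depend on
the slot and the pivots are their orbit maps, so that NOTHING is assumed:

* §1 **`sum_finrank_coeff_add_finrank_iSup_orbitSum_eq`** — for subgroups `N_j ≤ ⟨PW_j ∪ ⋂_{i≠j} PW_i⟩` (one per
  slot) the families `(MC_i)` and `(F_i^{N_i})` — `F_j^{N_j} = span{ g ↦ Σ_{x ∈ N_j·x₀} u_j(g·x) }` the ORBIT SUMS — have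
  the same defect: `Σ_i dim MC_i + dim ⨆_i F_i = Σ_i dim F_i + dim ⨆_i MC_i`; rank form
  **`sum_typeRank_add_one_add_finrank_iSup_orbitSum_eq`**.
* §2 THE CANONICAL CHOICE `N_j = ⋂_{i≠j} PW_i` (the pointwise stabiliser of all other slots; `= Aut(ℂ/L_{≠j})`,
  `L_{≠j}` the compositum of the other Galois closures): **`sum_typeRank_add_one_add_finrank_iSup_stabOrbitSum_eq`** —
  `Σ_i rank Φ_i + 1 + dim ⨆_j F_j = rank(Σ) + |I| + Σ_j dim F_j`, i.e.
  **`Σ_i dim Hg(A_i) − dim Hg(∏_i A_i) = Σ_j dim F_j − dim Σ_j F_j`** with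
  `F_j = span{ g ↦ Σ_{x : x = n·x₀, n fixing every other slot pointwise} u_j(g·x) : x₀ ∈ E_j }` — UNCONDITIONAL; the
  family is additive iff the `F_j` are INDEPENDENT (`typeRank_sigmaType_add_card_eq_iff_iSupIndep_stabOrbitSum`).
* §3 TYPE-FREE: `typeRank_sigmaType_add_card_eq_of_forall_stabOrbit_rho_stable` — if in every slot `j` every orbit of
  `⋂_{i≠j} PW_i` is stable under the conjugation `ρ`, then every `F_j = 0` and **`Hg(∏_i A_i) = ∏_i Hg(A_i)` for ALL CM
  types** (for `Aut(ℂ)`: every trace `K_j ∩ L_{≠j}` totally real — file C5 `…CanonicalPivotFamiliesCMFields`); one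
  exceptional slot is allowed
  (`…_of_forall_ne_stabOrbit_rho_stable`: a single non-zero `F_{j₀}` has nothing to collide with).

## References

* [Deligne1982HodgeCycles] P. Deligne, *Hodge cycles on abelian varieties*, LNM 900 (1982), I.5 (p. 62), I Ex. 3.7.
* [Gordon1999HodgeAVSurvey] B. B. Gordon, *A survey of the Hodge conjecture for abelian varieties*, §3 Theorem (Imai,
  Murty) with proof, 7.5–7.7, 9.4.3.
* [Serre1977] J.-P. Serre, *Linear Representations of Finite Groups*, GTM 42, §3.3, §7 Ex. 7.2.
* [Shimura1998] G. Shimura, *Abelian Varieties with Complex Multiplication and Modular Functions*, §8.1, §8.3.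
-/

set_option autoImplicit false

noncomputable section

open scoped BigOperators Classical

universe u v w

namespace Summit.HodgeConjecture.CorCM.IrrOdd

open Literature.NumberTheory.ComplexMultiplication

variable {G : Type w} [Group G] {I : Type u} {E : I → Type v} [∀ i, MulAction G (E i)] [Fintype I]
  [∀ i, Fintype (E i)]

/-! ### §1 Slot-dependent subgroups with orbit pivots -/

section OrbitSum

omit [Fintype I] in
/-- The fibre of the slotwise orbit map `x ↦ (j, N_j·x)` through `x₀ ∈ E_j` is the set of `N_j`-translates of `x₀`.
[folklore] -/
theorem filter_sigma_orbit_eq_eq_filter_exists_smul (N : I → Subgroup G) (j : I) (x₀ : E j) :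
    Finset.univ.filter (fun x : E j => (⟨j, MulAction.orbit (N j) x⟩ : (i : I) × Set (E i)) =
        ⟨j, MulAction.orbit (N j) x₀⟩) =
      Finset.univ.filter (fun x : E j => ∃ n ∈ N j, n • x₀ = x) := by
  rw [← filter_orbit_eq_eq_filter_exists_smul]
  refine Finset.filter_congr fun x _ => ?_
  rw [Sigma.mk.inj_iff, heq_iff_eq]
  exact and_iff_right rfl

/-- **THE FAMILY TRANSFER WITH ORBIT PIVOTS: `(MC_i)` and `(F_i^{N_i})` have the same defect** —
`Σ_i dim MC_i + dim ⨆_i F_i = Σ_i dim F_i + dim ⨆_i MC_i` — for ANY subgroups `N_j ≤ ⟨PW_j ∪ ⋂_{i≠j} PW_i⟩`, one per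
slot, `F_j` spanned by the `N_j`-orbit sums `g ↦ Σ_{x ∈ N_j·x₀} u_j(g·x)`: every component of a relation among matrix
coefficients is right-invariant under `PW_j` and `⋂_{i≠j} PW_i` (R5) and `N_j` is transitive on its own orbits (C1).
[cite: Gordon1999HodgeAVSurvey, §3 Theorem (proof)] [cite: Serre1977, §3.3] -/
theorem sum_finrank_coeff_add_finrank_iSup_orbitSum_eq (Φ : ∀ i, Set (E i)) (N : I → Subgroup G)
    (hNcl : ∀ j : I, (N j : Set G) ⊆ Subgroup.closure
      ({g : G | ∀ x : E j, g • x = x} ∪ {g : G | ∀ i, i ≠ j → ∀ x : E i, g • x = x})) :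
    (∑ i, Module.finrank ℚ (Submodule.span ℚ (Set.range fun x : E i => fun g : G => antiVec (Φ i) g x))) +
        Module.finrank ℚ (⨆ i, Submodule.span ℚ (Set.range fun x₀ : E i => fun g : G =>
          ∑ x ∈ Finset.univ.filter (fun x : E i => ∃ n ∈ N i, n • x₀ = x), antiVec (Φ i) g x) :
            Submodule ℚ (G → ℚ)) =
      (∑ i, Module.finrank ℚ (Submodule.span ℚ (Set.range fun x₀ : E i => fun g : G =>
          ∑ x ∈ Finset.univ.filter (fun x : E i => ∃ n ∈ N i, n • x₀ = x), antiVec (Φ i) g x))) +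
        Module.finrank ℚ (⨆ i, Submodule.span ℚ (Set.range fun x : E i => fun g : G => antiVec (Φ i) g x) :
          Submodule ℚ (G → ℚ)) := by
  haveI := fun i => finite_span_coeff (G := G) (Φ i)
  refine sum_finrank_add_finrank_iSup_eq_of_forall_rel _ _ (fun i => ?_) fun c hc hsum j => ?_
  · rw [Submodule.span_le]
    rintro _ ⟨x₀, rfl⟩
    exact sum_coeff_mem_span_coeff (Φ i) _
  · -- R5's component lemma with the orbit map of `N_j` as pivot
    have hmem := mem_span_fibreSum_of_rel Φ (Y := (i : I) × Set (E i))
      (fun i (x : E i) => (⟨i, MulAction.orbit (N i) x⟩ : (i : I) × Set (E i))) (N j) j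
      (fun x x' hxx' => exists_smul_eq_of_orbit_eq (N j) (by
        rw [Sigma.mk.inj_iff, heq_iff_eq] at hxx'
        exact hxx'.2)) (hNcl j) c hc hsum
    rw [span_fibreSum_eq_span_fibreSum_apply (Φ j)
      (fun x : E j => (⟨j, MulAction.orbit (N j) x⟩ : (i : I) × Set (E i)))] at hmem
    simp only [filter_sigma_orbit_eq_eq_filter_exists_smul] at hmem
    exact hmem

variable [∀ i, Nonempty (E i)] [Nonempty I]

/-- **The exact family defect with orbit pivots**: `Σ_i rank Φ_i + 1 + dim ⨆_i F_i^{N_i} = rank(Σ) + |I| + Σ_i dim F_i^{N_i}`,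
i.e. **`Σ_i dim Hg(A_i) − dim Hg(∏_i A_i) = Σ_i dim F_i − dim Σ_i F_i`**, for any `N_j ≤ ⟨PW_j ∪ ⋂_{i≠j} PW_i⟩`.
[cite: Deligne1982HodgeCycles, I.5 (p. 62)] [cite: Gordon1999HodgeAVSurvey, §3 Theorem and 7.7] -/
theorem sum_typeRank_add_one_add_finrank_iSup_orbitSum_eq {ρ : G} {Φ : ∀ i, Set (E i)}
    (h : ∀ i, IsCMTypeWith ρ (Φ i)) (N : I → Subgroup G)
    (hNcl : ∀ j : I, (N j : Set G) ⊆ Subgroup.closure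
      ({g : G | ∀ x : E j, g • x = x} ∪ {g : G | ∀ i, i ≠ j → ∀ x : E i, g • x = x})) :
    (∑ i, typeRank G (Φ i)) + 1 + Module.finrank ℚ (⨆ i, Submodule.span ℚ (Set.range fun x₀ : E i => fun g : G =>
          ∑ x ∈ Finset.univ.filter (fun x : E i => ∃ n ∈ N i, n • x₀ = x), antiVec (Φ i) g x) :
            Submodule ℚ (G → ℚ)) =
      typeRank G (sigmaType Φ) + Fintype.card I +
        ∑ i, Module.finrank ℚ (Submodule.span ℚ (Set.range fun x₀ : E i => fun g : G =>
          ∑ x ∈ Finset.univ.filter (fun x : E i => ∃ n ∈ N i, n • x₀ = x), antiVec (Φ i) g x)) := by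
  have h1 := typeRank_sigmaType_add_card_add_sum_finrank_eq h
  have h2 := sum_finrank_coeff_add_finrank_iSup_orbitSum_eq Φ N hNcl
  omega

end OrbitSum

/-! ### §2 The canonical choice: the pointwise stabiliser of all other slots -/

section Canonical

omit [Fintype I] [∀ i, Fintype (E i)] in
/-- Membership in `⋂_{i≠j} PW_i`: fixing every other slot pointwise. [cite: Serre1977, §7 Ex. 7.2] -/
theorem mem_iInf_ker_toPermHom_iff (j : I) (g : G) :
    g ∈ (⨅ (i : I) (_ : i ≠ j), (MulAction.toPermHom G (E i)).ker) ↔ ∀ i, i ≠ j → ∀ x : E i, g • x = x := by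
  simp only [Subgroup.mem_iInf, mem_ker_toPermHom_iff]

omit [Fintype I] in
/-- The orbits of `⋂_{i≠j} PW_i`, written out. [cite: Serre1977, §7 Ex. 7.2] -/
theorem filter_exists_mem_iInf_ker_eq (j : I) (x₀ : E j) :
    Finset.univ.filter
        (fun x : E j => ∃ n ∈ (⨅ (i : I) (_ : i ≠ j), (MulAction.toPermHom G (E i)).ker), n • x₀ = x) =
      Finset.univ.filter (fun x : E j => ∃ n : G, (∀ i, i ≠ j → ∀ y : E i, n • y = y) ∧ n • x₀ = x) :=
  Finset.filter_congr fun x _ => by simp only [mem_iInf_ker_toPermHom_iff]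

variable [∀ i, Nonempty (E i)] [Nonempty I]

/-- **THE CANONICAL FAMILY PIVOT — NO HYPOTHESIS: `Σ_i rank Φ_i + 1 + dim ⨆_j F_j = rank(Σ) + |I| + Σ_j dim F_j`**, i.e.
**`Σ_i dim Hg(A_i) − dim Hg(∏_i A_i) = Σ_j dim F_j − dim Σ_j F_j`**, where `F_j ≤ ℚ^G` is spanned by the matrix
coefficients of slot `j` summed over the orbits of the POINTWISE STABILISER OF ALL OTHER SLOTS:
`F_j = span{ g ↦ Σ_{x = n·x₀, n fixing E_i pointwise ∀ i ≠ j} u_j(g·x) : x₀ ∈ E_j }`.  Gen 64 R5's (GL) is gone.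
[cite: Deligne1982HodgeCycles, I.5 (p. 62)] [cite: Gordon1999HodgeAVSurvey, §3 Theorem and 7.5–7.7] -/
theorem sum_typeRank_add_one_add_finrank_iSup_stabOrbitSum_eq {ρ : G} {Φ : ∀ i, Set (E i)}
    (h : ∀ i, IsCMTypeWith ρ (Φ i)) :
    (∑ i, typeRank G (Φ i)) + 1 + Module.finrank ℚ (⨆ j, Submodule.span ℚ (Set.range fun x₀ : E j => fun g : G =>
          ∑ x ∈ Finset.univ.filter
            (fun x : E j => ∃ n : G, (∀ i, i ≠ j → ∀ y : E i, n • y = y) ∧ n • x₀ = x), antiVec (Φ j) g x) :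
            Submodule ℚ (G → ℚ)) =
      typeRank G (sigmaType Φ) + Fintype.card I +
        ∑ j, Module.finrank ℚ (Submodule.span ℚ (Set.range fun x₀ : E j => fun g : G =>
          ∑ x ∈ Finset.univ.filter
            (fun x : E j => ∃ n : G, (∀ i, i ≠ j → ∀ y : E i, n • y = y) ∧ n • x₀ = x), antiVec (Φ j) g x)) := by
  have hmain := sum_typeRank_add_one_add_finrank_iSup_orbitSum_eq h
    (fun j => ⨅ (i : I) (_ : i ≠ j), (MulAction.toPermHom G (E i)).ker)
    (fun j n hn => Subgroup.subset_closure (Or.inr ((mem_iInf_ker_toPermHom_iff j n).1 hn)))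
  -- rewrite the orbit condition slot by slot (under `⨆` and `Σ`, through congruence)
  have e : ∀ j : I, Submodule.span ℚ (Set.range fun x₀ : E j => fun g : G =>
      ∑ x ∈ Finset.univ.filter (fun x : E j =>
        ∃ n ∈ (⨅ (i : I) (_ : i ≠ j), (MulAction.toPermHom G (E i)).ker), n • x₀ = x), antiVec (Φ j) g x) =
      Submodule.span ℚ (Set.range fun x₀ : E j => fun g : G =>
        ∑ x ∈ Finset.univ.filter
          (fun x : E j => ∃ n : G, (∀ i, i ≠ j → ∀ y : E i, n • y = y) ∧ n • x₀ = x), antiVec (Φ j) g x) :=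
    fun j => by simp only [filter_exists_mem_iInf_ker_eq]
  have e2 : (∑ j, Module.finrank ℚ (Submodule.span ℚ (Set.range fun x₀ : E j => fun g : G =>
      ∑ x ∈ Finset.univ.filter (fun x : E j =>
        ∃ n ∈ (⨅ (i : I) (_ : i ≠ j), (MulAction.toPermHom G (E i)).ker), n • x₀ = x), antiVec (Φ j) g x))) =
      ∑ j, Module.finrank ℚ (Submodule.span ℚ (Set.range fun x₀ : E j => fun g : G =>
        ∑ x ∈ Finset.univ.filter
          (fun x : E j => ∃ n : G, (∀ i, i ≠ j → ∀ y : E i, n • y = y) ∧ n • x₀ = x), antiVec (Φ j) g x)) :=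
    Finset.sum_congr rfl fun j _ => by rw [e j]
  rw [iSup_congr e, e2] at hmain
  exact hmain

/-- **The family is additive (`Hg(∏_i A_i) = ∏_i Hg(A_i)`) iff the canonical orbit-sum spaces `F_j` are INDEPENDENT**
(`dim ⨆_j F_j = Σ_j dim F_j`) — unconditional criterion. [cite: Gordon1999HodgeAVSurvey, §3 Theorem and 7.5–7.7] -/
theorem typeRank_sigmaType_add_card_eq_iff_iSupIndep_stabOrbitSum {ρ : G} {Φ : ∀ i, Set (E i)}
    (h : ∀ i, IsCMTypeWith ρ (Φ i)) :
    typeRank G (sigmaType Φ) + Fintype.card I = (∑ i, typeRank G (Φ i)) + 1 ↔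
      iSupIndep fun j => Submodule.span ℚ (Set.range fun x₀ : E j => fun g : G =>
        ∑ x ∈ Finset.univ.filter
          (fun x : E j => ∃ n : G, (∀ i, i ≠ j → ∀ y : E i, n • y = y) ∧ n • x₀ = x), antiVec (Φ j) g x) := by
  haveI : ∀ j : I, Module.Finite ℚ (Submodule.span ℚ (Set.range fun x₀ : E j => fun g : G =>
      ∑ x ∈ Finset.univ.filter
        (fun x : E j => ∃ n : G, (∀ i, i ≠ j → ∀ y : E i, n • y = y) ∧ n • x₀ = x), antiVec (Φ j) g x)) := by
    intro j
    haveI := finite_span_coeff (G := G) (Φ j)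
    have hle : Submodule.span ℚ (Set.range fun x₀ : E j => fun g : G =>
        ∑ x ∈ Finset.univ.filter
          (fun x : E j => ∃ n : G, (∀ i, i ≠ j → ∀ y : E i, n • y = y) ∧ n • x₀ = x), antiVec (Φ j) g x) ≤
        Submodule.span ℚ (Set.range fun x : E j => fun g : G => antiVec (Φ j) g x) := by
      rw [Submodule.span_le]
      rintro _ ⟨x₀, rfl⟩
      exact sum_coeff_mem_span_coeff (Φ j) _
    exact Module.Finite.of_injective (Submodule.inclusion hle) (Submodule.inclusion_injective hle)
  rw [← finrank_iSup_eq_sum_finrank_iff_iSupIndep]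
  have := sum_typeRank_add_one_add_finrank_iSup_stabOrbitSum_eq h
  omega

/-! ### §3 Type-free consequences -/

omit [Fintype I] [∀ i, Nonempty (E i)] [Nonempty I] in
/-- **A `ρ`-odd vector sums to zero over a `ρ`-stable orbit of `⋂_{i≠j} PW_i`** (any translate `u_j(g·)`).
[cite: Shimura1998, §8.3] -/
theorem stabOrbit_sum_antiVec_eq_zero_of_rho_mem_family {ρ : G} {Φ : ∀ i, Set (E i)}
    (h : ∀ i, IsCMTypeWith ρ (Φ i)) (j : I) (x₀ : E j)
    (hρ : ∃ n : G, (∀ i, i ≠ j → ∀ y : E i, n • y = y) ∧ n • x₀ = ρ • x₀) (g : G) :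
    ∑ x ∈ Finset.univ.filter
      (fun x : E j => ∃ n : G, (∀ i, i ≠ j → ∀ y : E i, n • y = y) ∧ n • x₀ = x), antiVec (Φ j) g x = 0 := by
  obtain ⟨n₀, hn₀, hn₀x⟩ := hρ
  refine Finset.sum_involution (fun x _ => ρ • x) (fun x _ => ?_) (fun x _ _ => (h j).rho_smul_ne x)
    (fun x hx => ?_) (fun x _ => (h j).invol x)
  · simp only [antiVec, (h j).translateInd_rho_smul]
    ring
  · simp only [Finset.mem_filter, Finset.mem_univ, true_and] at hx ⊢
    obtain ⟨n, hn, rfl⟩ := hx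
    exact ⟨n * n₀, fun i hi y => by rw [mul_smul, hn₀ i hi, hn i hi], by rw [mul_smul, hn₀x, (h j).comm]⟩

omit [Fintype I] [∀ i, Nonempty (E i)] [Nonempty I] in
/-- If every orbit of `⋂_{i≠j} PW_i` on `E_j` is `ρ`-stable, the canonical orbit-sum space `F_j` is `0`.
[cite: Shimura1998, §8.3] -/
theorem span_stabOrbitSum_eq_bot_of_rho_stable {ρ : G} {Φ : ∀ i, Set (E i)} (h : ∀ i, IsCMTypeWith ρ (Φ i)) (j : I)
    (hρ : ∀ x₀ : E j, ∃ n : G, (∀ i, i ≠ j → ∀ y : E i, n • y = y) ∧ n • x₀ = ρ • x₀) :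
    Submodule.span ℚ (Set.range fun x₀ : E j => fun g : G =>
        ∑ x ∈ Finset.univ.filter
          (fun x : E j => ∃ n : G, (∀ i, i ≠ j → ∀ y : E i, n • y = y) ∧ n • x₀ = x), antiVec (Φ j) g x) =
      (⊥ : Submodule ℚ (G → ℚ)) := by
  rw [Submodule.span_eq_bot]
  rintro _ ⟨x₀, rfl⟩
  funext g
  exact stabOrbit_sum_antiVec_eq_zero_of_rho_mem_family h j x₀ (hρ x₀) g

/-- **TYPE-FREE ADDITIVITY FOR FAMILIES**: if in every slot `j` every orbit of `⋂_{i≠j} PW_i` on `E_j` is stable under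
the conjugation `ρ`, then `Hg(∏_i A_i) = ∏_i Hg(A_i)` for EVERY family of CM types (for `ρ`) — all the canonical
orbit-sum spaces vanish. [cite: Gordon1999HodgeAVSurvey, §3 Theorem (proof) and 7.5–7.7] [cite: Shimura1998, §8.3] -/
theorem typeRank_sigmaType_add_card_eq_of_forall_stabOrbit_rho_stable {ρ : G} {Φ : ∀ i, Set (E i)}
    (h : ∀ i, IsCMTypeWith ρ (Φ i))
    (hρ : ∀ (j : I) (x₀ : E j), ∃ n : G, (∀ i, i ≠ j → ∀ y : E i, n • y = y) ∧ n • x₀ = ρ • x₀) :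
    typeRank G (sigmaType Φ) + Fintype.card I = (∑ i, typeRank G (Φ i)) + 1 := by
  have hmain := sum_typeRank_add_one_add_finrank_iSup_stabOrbitSum_eq h
  have h0 : ∀ j : I, Submodule.span ℚ (Set.range fun x₀ : E j => fun g : G =>
      ∑ x ∈ Finset.univ.filter
        (fun x : E j => ∃ n : G, (∀ i, i ≠ j → ∀ y : E i, n • y = y) ∧ n • x₀ = x), antiVec (Φ j) g x) =
      (⊥ : Submodule ℚ (G → ℚ)) := fun j => span_stabOrbitSum_eq_bot_of_rho_stable h j (hρ j)
  have e2 : (∑ j, Module.finrank ℚ (Submodule.span ℚ (Set.range fun x₀ : E j => fun g : G =>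
      ∑ x ∈ Finset.univ.filter
        (fun x : E j => ∃ n : G, (∀ i, i ≠ j → ∀ y : E i, n • y = y) ∧ n • x₀ = x), antiVec (Φ j) g x))) = 0 :=
    Finset.sum_eq_zero fun j _ => by rw [h0 j, finrank_bot]
  rw [(iSup_congr h0).trans iSup_bot, finrank_bot, e2] at hmain
  omega

/-- **One exceptional slot is allowed**: if the orbits are `ρ`-stable in every slot EXCEPT possibly `j₀`, the family is
still additive (a single non-zero `F_{j₀}` has nothing to collide with).
[cite: Gordon1999HodgeAVSurvey, §3 Theorem (proof) and 7.5–7.7] -/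
theorem typeRank_sigmaType_add_card_eq_of_forall_ne_stabOrbit_rho_stable {ρ : G} {Φ : ∀ i, Set (E i)}
    (h : ∀ i, IsCMTypeWith ρ (Φ i)) (j₀ : I)
    (hρ : ∀ j : I, j ≠ j₀ → ∀ x₀ : E j, ∃ n : G, (∀ i, i ≠ j → ∀ y : E i, n • y = y) ∧ n • x₀ = ρ • x₀) :
    typeRank G (sigmaType Φ) + Fintype.card I = (∑ i, typeRank G (Φ i)) + 1 := by
  have hmain := sum_typeRank_add_one_add_finrank_iSup_stabOrbitSum_eq h
  have h0 : ∀ j : I, j ≠ j₀ → Submodule.span ℚ (Set.range fun x₀ : E j => fun g : G =>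
      ∑ x ∈ Finset.univ.filter
        (fun x : E j => ∃ n : G, (∀ i, i ≠ j → ∀ y : E i, n • y = y) ∧ n • x₀ = x), antiVec (Φ j) g x) =
      (⊥ : Submodule ℚ (G → ℚ)) := fun j hj => span_stabOrbitSum_eq_bot_of_rho_stable h j (hρ j hj)
  have hsup : (⨆ j, Submodule.span ℚ (Set.range fun x₀ : E j => fun g : G =>
      ∑ x ∈ Finset.univ.filter
        (fun x : E j => ∃ n : G, (∀ i, i ≠ j → ∀ y : E i, n • y = y) ∧ n • x₀ = x), antiVec (Φ j) g x) :
        Submodule ℚ (G → ℚ)) =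
      Submodule.span ℚ (Set.range fun x₀ : E j₀ => fun g : G =>
        ∑ x ∈ Finset.univ.filter
          (fun x : E j₀ => ∃ n : G, (∀ i, i ≠ j₀ → ∀ y : E i, n • y = y) ∧ n • x₀ = x), antiVec (Φ j₀) g x) := by
    refine le_antisymm (iSup_le fun j => ?_) (le_iSup (fun j => Submodule.span ℚ (Set.range fun x₀ : E j =>
      fun g : G => ∑ x ∈ Finset.univ.filter
        (fun x : E j => ∃ n : G, (∀ i, i ≠ j → ∀ y : E i, n • y = y) ∧ n • x₀ = x), antiVec (Φ j) g x)) j₀)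
    by_cases hj : j = j₀
    · subst hj
      exact le_rfl
    · rw [h0 j hj]
      exact bot_le
  have hsum : (∑ j, Module.finrank ℚ (Submodule.span ℚ (Set.range fun x₀ : E j => fun g : G =>
      ∑ x ∈ Finset.univ.filter
        (fun x : E j => ∃ n : G, (∀ i, i ≠ j → ∀ y : E i, n • y = y) ∧ n • x₀ = x), antiVec (Φ j) g x))) =
      Module.finrank ℚ (Submodule.span ℚ (Set.range fun x₀ : E j₀ => fun g : G =>
        ∑ x ∈ Finset.univ.filter
          (fun x : E j₀ => ∃ n : G, (∀ i, i ≠ j₀ → ∀ y : E i, n • y = y) ∧ n • x₀ = x), antiVec (Φ j₀) g x)) := by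
    rw [Finset.sum_eq_single j₀ (fun j _ hj => by rw [h0 j hj, finrank_bot]) (fun hj => (hj (Finset.mem_univ _)).elim)]
  rw [hsup, hsum] at hmain
  omega

end Canonical

end Summit.HodgeConjecture.CorCM.IrrOdd

end
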